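import Summits.QuantumAdvantage.QuantumAdvantage.Theorems.LinnikCubicClassGroupsDegreeOnePrimesEscapeSmallRootDiscriminant
import Literature.NumberTheory.NumberFields.HilbertClassFieldOfCharacters
import Literature.NumberTheory.LFunctions.PrimesInRayClasses
import Literature.NumberTheory.LFunctions.NumberFieldDirichletDensityCalculus
import HarnessLib

/-!
# Prime ideals are equidistributed in ideal classes; the Hilbert class field has degree `≥ h_K`;
# Masley–Montgomery: a field of small root discriminant has bounded class number

Topic `Summits/QuantumAdvantage/QuantumAdvantage/Theorems`, helper file for the crux
`DegreeOnePrimesEscape` (stmt-QuantumAdvantage-11543, closed) of route `LinnikCubicClassGroups`;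
cell B2b-1 (linnik-cubic), PART A. HONEST FRAMING: the value of this file is a THEOREM — NOT summit
progress.

* `artinSymbol_classDatum`, `artinKillsRay_classDatum`, `exists_char_classDatum_ne_one` — the datum
  `𝔭 ↦ [𝔭] ∈ Cl(𝓞_K)` extends multiplicatively to `𝔞 ↦ [𝔞]`, kills every principal ideal (the "ray
  modulo `(1)`"), and separates the characters of `Cl(𝓞_K)` (prime classes generate);
* `hasStrongDirichletDensity_classFiber` — **Dirichlet–Landau: the prime ideals of `K` in a given
  ideal class have (strong) Dirichlet density `1/h_K`** (the tree's
  `hasStrongDirichletDensity_frobFiber_of_artinKillsRay`, i.e. `L(1,χ) ≠ 0` for class-group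
  characters); `hasStrongDirichletDensity_isPrincipal` — the principal primes have density `1/h_K`;
* `le_of_hasStrongDirichletDensity_of_subset` — monotonicity of (strong) Dirichlet densities under
  inclusion up to finitely many / non-degree-one primes;
* `exists_unramified_classNumber_le_finrank` — **there is a finite Galois `H/K`, unramified at every
  finite prime, with `h_K ≤ [H:K]`**: the field of the tree's `exists_hilbertClassField_data`
  (compositum of the class fields of the characters of `Cl(𝓞_K)`): its completely split primes
  (density `1/[H:K]`, `hasStrongDirichletDensity_splitPrimes`) are eventually principal
  (density `1/h_K`);
* `classNumber_mul_finrank_le` — **Masley–Montgomery with Stark's constant**: if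
  `log|d_K| < n(log 2π + γ)` (root discriminant below `2πe^γ ≈ 11.19`) then
  `h_K · n ≤ ((π√2 + 2)n/(n(log 2π + γ) − log|d_K|))²`; and conversely (`log_absdiscr_ge_of_classNumber`)
  `log|d_K| ≥ n(log 2π + γ) − (π√2 + 2)√(n/h_K)` for every number field.

## References

* J. M. Masley, H. L. Montgomery, *Cyclotomic fields with unique factorization*, J. reine angew.
  Math. 286/287 (1976) 248–256. [MasleyMontgomery1976]
* E. Landau, *Über Ideale und Primideale in Idealklassen*, Math. Z. 2 (1918). [Landau1918Idealklassen]
* J. Neukirch, *Algebraic Number Theory*, VII (13.2), VI (6.9). [NeukirchANT1999]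
-/

noncomputable section

open scoped NumberField nonZeroDivisors
open Complex Filter Topology Set NumberField NumberField.InfinitePlace IsDedekindDomain
  IsDedekindDomain.HeightOneSpectrum

namespace Summit.QuantumAdvantage.QuantumAdvantage.Theorems.DegreeOnePrimesEscape

namespace Discriminant

open Literature.NumberTheory.LFunctions Literature.NumberTheory.LFunctions.NumberField
  Literature.NumberTheory.LFunctions.AbelianDensity Literature.NumberTheory.NumberFields
  Literature.NumberTheory.GaloisRepresentations

variable {K : Type} [Field K] [NumberField K]

/-! ### The class datum `𝔭 ↦ [𝔭]` -/

/-- **The multiplicative extension of `𝔭 ↦ [𝔭]` to a nonzero integral ideal is its class**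
(unique factorisation). [folklore] -/
theorem artinSymbol_classDatum {I : Ideal (𝓞 K)} (hI : I ≠ ⊥) :
    artinSymbol (fun v : HeightOneSpectrum (𝓞 K) ↦
        ClassGroup.mk0 ⟨v.asIdeal, asIdeal_mem_nonZeroDivisors v⟩) I =
      ClassGroup.mk0 ⟨I, mem_nonZeroDivisors_of_ne_zero (by rwa [Submodule.zero_eq_bot])⟩ := by
  classical
  induction I using UniqueFactorizationMonoid.induction_on_prime with
  | h₁ => exact absurd (Submodule.zero_eq_bot) hI
  | h₂ I hu =>
    obtain rfl : I = ⊤ := Ideal.isUnit_iff.mp hu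
    rw [artinSymbol_top]
    exact ((ClassGroup.mk0_eq_one_iff _).mpr ⟨⟨1, by simp⟩⟩).symm
  | h₃ J p hJ0 hp ih =>
    have hp0 : p ≠ ⊥ := hp.ne_zero
    have hpP : p.IsPrime := Ideal.isPrime_of_prime hp
    set v : HeightOneSpectrum (𝓞 K) := ⟨p, hpP, hp0⟩ with hvdef
    have h1 : artinSymbol (fun v : HeightOneSpectrum (𝓞 K) ↦
        ClassGroup.mk0 ⟨v.asIdeal, asIdeal_mem_nonZeroDivisors v⟩) p =
        ClassGroup.mk0 ⟨p, mem_nonZeroDivisors_of_ne_zero (by rwa [Submodule.zero_eq_bot])⟩ :=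
      artinSymbol_asIdeal _ v
    rw [artinSymbol_mul _ hp0 hJ0, h1, ih hJ0, ← map_mul]
    congr 1

/-- **The class datum kills every principal ideal** (the ray `P_K^{(1)}`): `[(b)] = [(c)] = 1`.
[folklore] -/
theorem artinKillsRay_classDatum :
    ArtinKillsRay (⊤ : Ideal (𝓞 K)) (fun v : HeightOneSpectrum (𝓞 K) ↦
      ClassGroup.mk0 ⟨v.asIdeal, asIdeal_mem_nonZeroDivisors v⟩) := by
  intro b c hb hc _ _ _
  have hb' : Ideal.span {b} ≠ ⊥ := by rwa [Ne, Ideal.span_singleton_eq_bot]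
  have hc' : Ideal.span {c} ≠ ⊥ := by rwa [Ne, Ideal.span_singleton_eq_bot]
  rw [artinSymbol_classDatum hb', artinSymbol_classDatum hc',
    (ClassGroup.mk0_eq_one_iff _).mpr ⟨⟨b, rfl⟩⟩, (ClassGroup.mk0_eq_one_iff _).mpr ⟨⟨c, rfl⟩⟩]

/-- **The prime classes generate `Cl(𝓞_K)`**: a subgroup containing every `[𝔭]` is everything.
[folklore] -/
theorem classDatum_generate (H : Subgroup (ClassGroup (𝓞 K)))
    (hH : ∀ v : HeightOneSpectrum (𝓞 K),
      ClassGroup.mk0 ⟨v.asIdeal, asIdeal_mem_nonZeroDivisors v⟩ ∈ H) : H = ⊤ := by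
  classical
  rw [eq_top_iff]
  intro g _
  obtain ⟨⟨I, hI⟩, rfl⟩ := ClassGroup.mk0_surjective g
  have hI0 : I ≠ ⊥ := nonZeroDivisors.ne_zero hI
  have h := artinSymbol_classDatum (K := K) hI0
  rw [← h, artinSymbol]
  exact finprod_induction (· ∈ H) H.one_mem (fun _ _ hx hy ↦ H.mul_mem hx hy)
    fun v ↦ H.pow_mem (hH v) _

/-- A non-trivial character of `Cl(𝓞_K)` is `≠ 1` at the class of some prime. [folklore] -/
theorem exists_char_classDatum_ne_one (χ : AddChar (Additive (ClassGroup (𝓞 K))) ℂ) (hχ : χ ≠ 0) :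
    ∃ v : HeightOneSpectrum (𝓞 K), ¬ (⊤ : Ideal (𝓞 K)) ≤ v.asIdeal ∧
      χ (Additive.ofMul (ClassGroup.mk0 ⟨v.asIdeal, asIdeal_mem_nonZeroDivisors v⟩)) ≠ 1 := by
  by_contra hall
  push Not at hall
  have hnot : ∀ v : HeightOneSpectrum (𝓞 K), ¬ (⊤ : Ideal (𝓞 K)) ≤ v.asIdeal :=
    fun v h ↦ v.isPrime.ne_top (top_le_iff.mp h)
  set H : Subgroup (ClassGroup (𝓞 K)) :=
    (toMulHom (G := ClassGroup (𝓞 K)) χ).toHomUnits.ker with hH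
  have hmem : ∀ g : ClassGroup (𝓞 K), g ∈ H ↔ χ (Additive.ofMul g) = 1 := fun g ↦ by
    rw [hH, MonoidHom.mem_ker, Units.ext_iff, MonoidHom.coe_toHomUnits, toMulHom_apply,
      Units.val_one]
  have hHtop : H = ⊤ := classDatum_generate H fun v ↦ (hmem _).mpr (hall v (hnot v))
  apply hχ
  rw [AddChar.eq_zero_iff]
  intro x
  have hx : Additive.toMul x ∈ H := by rw [hHtop]; exact Subgroup.mem_top _
  rw [hmem] at hx
  simpa only [ofMul_toMul] using hx

/-! ### Equidistribution of prime ideals in ideal classes -/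

variable (K) in
/-- **Dirichlet–Landau: the prime ideals in a given ideal class have strong Dirichlet density `1/h_K`**
(`L(1,χ) ≠ 0` for the characters of `Cl(𝓞_K)`, through the tree's
`hasStrongDirichletDensity_frobFiber_of_artinKillsRay` with modulus `(1)`).
[cite: Landau1918Idealklassen, §1 Satz] [cite: NeukirchANT1999, Ch. VII (13.2)] -/
theorem hasStrongDirichletDensity_classFiber (c : ClassGroup (𝓞 K)) :
    HasStrongDirichletDensity K
      {v : HeightOneSpectrum (𝓞 K) | ClassGroup.mk0 ⟨v.asIdeal, asIdeal_mem_nonZeroDivisors v⟩ = c}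
      (1 / classNumber K) := by
  classical
  have h := hasStrongDirichletDensity_frobFiber_of_artinKillsRay (𝔪 := (⊤ : Ideal (𝓞 K)))
    (by simp) artinKillsRay_classDatum exists_char_classDatum_ne_one c
  have hnot : ∀ v : HeightOneSpectrum (𝓞 K), ¬ (⊤ : Ideal (𝓞 K)) ≤ v.asIdeal :=
    fun v h ↦ v.isPrime.ne_top (top_le_iff.mp h)
  have hset : frobFiber (⊤ : Ideal (𝓞 K)) (fun v : HeightOneSpectrum (𝓞 K) ↦
      ClassGroup.mk0 ⟨v.asIdeal, asIdeal_mem_nonZeroDivisors v⟩) c =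
      {v : HeightOneSpectrum (𝓞 K) |
        ClassGroup.mk0 ⟨v.asIdeal, asIdeal_mem_nonZeroDivisors v⟩ = c} := by
    ext v
    rw [mem_frobFiber]
    exact ⟨fun h ↦ h.2, fun h ↦ ⟨hnot v, h⟩⟩
  rw [hset] at h
  rw [classNumber, ← Nat.card_eq_fintype_card]
  exact h

variable (K) in
/-- **The principal prime ideals have strong Dirichlet density `1/h_K`.**
[cite: Landau1918Idealklassen, §1 Satz] -/
theorem hasStrongDirichletDensity_isPrincipal :
    HasStrongDirichletDensity K {v : HeightOneSpectrum (𝓞 K) | v.asIdeal.IsPrincipal}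
      (1 / classNumber K) := by
  have h := hasStrongDirichletDensity_classFiber K 1
  refine h.of_finite_symmDiff Set.finite_empty fun v _ ↦ ?_
  simp only [Set.mem_setOf_eq]
  exact ClassGroup.mk0_eq_one_iff _

/-! ### Monotonicity of densities -/

/-- Strong density depends only on the degree-one members of the set. [folklore] -/
theorem HasStrongDirichletDensity.congr_prime {X Y : Set (HeightOneSpectrum (𝓞 K))} {c : ℝ}
    (hX : HasStrongDirichletDensity K X c)
    (h : ∀ v : HeightOneSpectrum (𝓞 K), (Ideal.absNorm v.asIdeal).Prime → (v ∈ X ↔ v ∈ Y)) :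
    HasStrongDirichletDensity K Y c := by
  have heq : ∀ p : Nat.Primes, (primeNormCount K X p : ℝ) = primeNormCount K Y p := by
    intro p
    rw [primeNormCount_eq_sum_indicator, primeNormCount_eq_sum_indicator]
    refine Finset.sum_congr rfl fun q hq ↦ ?_
    rw [mem_primesOfNorm] at hq
    have hiff := h q (hq ▸ p.prop)
    by_cases hqX : q ∈ X
    · rw [Set.indicator_of_mem hqX, Set.indicator_of_mem (hiff.mp hqX)]
    · rw [Set.indicator_of_notMem hqX, Set.indicator_of_notMem (fun hY ↦ hqX (hiff.mpr hY))]
  rw [hasStrongDirichletDensity_iff] at hX ⊢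
  obtain ⟨L, hL⟩ := hX
  refine ⟨L, hL.congr' (Filter.Eventually.of_forall fun s ↦ ?_)⟩
  congr 1
  exact tsum_congr fun p ↦ by rw [heq p]

/-- **Monotonicity of densities**: if `X` and `Y` have strong Dirichlet densities `a` and `b` and
every degree-one prime of `X` outside a finite set lies in `Y`, then `a ≤ b`. [folklore] -/
theorem le_of_hasStrongDirichletDensity_of_subset {X Y : Set (HeightOneSpectrum (𝓞 K))} {a b : ℝ}
    (hX : HasStrongDirichletDensity K X a) (hY : HasStrongDirichletDensity K Y b)
    {E : Set (HeightOneSpectrum (𝓞 K))} (hE : E.Finite)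
    (hsub : ∀ v : HeightOneSpectrum (𝓞 K), (Ideal.absNorm v.asIdeal).Prime → v ∉ E → v ∈ X → v ∈ Y) :
    a ≤ b := by
  -- replace `X` by `X \ E` and `Y` by `Y ∪ {non-degree-one members of X \ E}`
  set X₁ : Set (HeightOneSpectrum (𝓞 K)) := X \ E with hX₁
  set Y₁ : Set (HeightOneSpectrum (𝓞 K)) :=
    Y ∪ {v | v ∈ X₁ ∧ ¬ (Ideal.absNorm v.asIdeal).Prime} with hY₁
  have hX₁d : HasStrongDirichletDensity K X₁ a :=
    hX.of_finite_symmDiff hE fun q hq ↦ by simp [hX₁, hq]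
  have hY₁d : HasStrongDirichletDensity K Y₁ b :=
    HasStrongDirichletDensity.congr_prime hY fun v hv ↦ by
      simp only [hY₁, Set.mem_union, Set.mem_setOf_eq]
      exact ⟨fun h ↦ Or.inl h, fun h ↦ h.elim id fun h' ↦ absurd hv h'.2⟩
  have hsub₁ : X₁ ⊆ Y₁ := by
    intro v hv
    by_cases hp : (Ideal.absNorm v.asIdeal).Prime
    · exact Or.inl (hsub v hp hv.2 hv.1)
    · exact Or.inr ⟨hv, hp⟩
  -- pass to Neukirch densities and compare the limits
  have hXD := hX₁d.numberField_hasDirichletDensity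
  have hYD := hY₁d.numberField_hasDirichletDensity
  rw [NumberField.hasDirichletDensity_iff] at hXD hYD
  refine le_of_tendsto_of_tendsto hXD hYD ?_
  filter_upwards [self_mem_nhdsWithin] with s hs
  exact div_le_div_of_nonneg_right (NumberField.tsum_indicator_mono hsub₁ hs)
    (tsum_nonneg fun v ↦ NumberField.absNorm_rpow_neg_nonneg v s)

/-! ### The Hilbert class field has degree at least `h_K` -/

variable (K) in
/-- **An everywhere-unramified Galois extension of degree `≥ h_K`**: the field `H` of the tree's
`exists_hilbertClassField_data` (finite Galois over `K`, unramified at every finite prime, all but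
finitely many of whose completely split degree-one primes are principal) satisfies `h_K ≤ [H:K]`:
its split primes have density `1/[H:K]` and lie, up to finitely many, among the principal primes,
of density `1/h_K`. [cite: NeukirchANT1999, Ch. VI §6 Prop. (6.9)] -/
theorem exists_unramified_classNumber_le_finrank :
    ∃ H : IntermediateField K (AlgebraicClosure K), FiniteDimensional K H ∧ IsGalois K H ∧
      (∀ (P : Ideal (𝓞 H)) [P.IsMaximal], Algebra.IsUnramifiedAt (𝓞 K) P) ∧
      classNumber K ≤ Module.finrank K H := by
  obtain ⟨H, hfd, hgal, hunr, hprin⟩ := exists_hilbertClassField_data K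
  haveI := hfd
  haveI := hgal
  haveI : NumberField H := NumberField.of_module_finite K H
  refine ⟨H, hfd, hgal, hunr, ?_⟩
  have hS := hasStrongDirichletDensity_splitPrimes K H
  have hP := hasStrongDirichletDensity_isPrincipal K
  rw [Filter.eventually_cofinite] at hprin
  have hle := le_of_hasStrongDirichletDensity_of_subset hS hP hprin fun v hv hvE hvS ↦ by
    by_contra hnp
    exact hvE (by simp only [Set.mem_setOf_eq]; exact fun h ↦ hnp (h hv hvS))
  have hh : (0 : ℝ) < classNumber K := by exact_mod_cast classNumber_pos K
  have hd : (0 : ℝ) < Module.finrank K H := by exact_mod_cast Module.finrank_pos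
  have := (one_div_le_one_div hd hh).mp hle
  exact_mod_cast this

/-! ### Masley–Montgomery: small root discriminant bounds the class number -/

variable (K) in
/-- **Masley–Montgomery with Stark's constant: a field of small root discriminant has bounded class
number.**  If `log|d_K| < n(log 2π + γ)` (`n = [K:ℚ]`; root discriminant below `2πe^γ ≈ 11.19`), then
`h_K · n ≤ ((π√2 + 2)·n / (n(log 2π + γ) − log|d_K|))²`.
[cite: MasleyMontgomery1976, §1 (method)] -/
theorem classNumber_mul_finrank_le
    (hsmall : Real.log ((discr K).natAbs : ℝ) <
      Module.finrank ℚ K * (Real.log (2 * Real.pi) + Real.eulerMascheroniConstant)) :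
    ((classNumber K * Module.finrank ℚ K : ℕ) : ℝ) ≤
      ((Real.pi * Real.sqrt 2 + 2) * Module.finrank ℚ K /
        (Module.finrank ℚ K * (Real.log (2 * Real.pi) + Real.eulerMascheroniConstant) -
          Real.log ((discr K).natAbs : ℝ))) ^ 2 := by
  obtain ⟨H, hfd, hgal, hunr, hle⟩ := exists_unramified_classNumber_le_finrank K
  haveI := hfd
  haveI : NumberField H := NumberField.of_module_finite K H
  have h := finrank_le_of_natAbs_discr_eq_pow K H (natAbs_discr_eq_pow_of_forall_isUnramifiedAt hunr)
    hsmall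
  have hN : Module.finrank ℚ H = Module.finrank K H * Module.finrank ℚ K := by
    rw [← Module.finrank_mul_finrank ℚ K H, mul_comm]
  rw [hN] at h
  refine le_trans ?_ h
  exact_mod_cast Nat.mul_le_mul_right _ hle

variable (K) in
/-- **Converse reading: `log|d_K| ≥ n(log 2π + γ) − (π√2 + 2)√(n/h_K)`** for every number field `K`
of degree `n` — a large class number forces a root discriminant close to `2πe^γ` from below at worst.
[cite: MasleyMontgomery1976, §1 (method)] -/
theorem log_absdiscr_ge_of_classNumber :
    Module.finrank ℚ K * (Real.log (2 * Real.pi) + Real.eulerMascheroniConstant) -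
        (Real.pi * Real.sqrt 2 + 2) * Real.sqrt (Module.finrank ℚ K / classNumber K) ≤
      Real.log ((discr K).natAbs : ℝ) := by
  set n : ℝ := (Module.finrank ℚ K : ℝ) with hn_def
  set m : ℝ := (classNumber K : ℝ) with hm_def
  set A : ℝ := Real.log (2 * Real.pi) + Real.eulerMascheroniConstant
  set ℓ : ℝ := Real.log ((discr K).natAbs : ℝ)
  set B : ℝ := Real.pi * Real.sqrt 2 + 2 with hB_def
  have hn : 0 < n := by rw [hn_def]; exact_mod_cast Module.finrank_pos
  have hm : 0 < m := by rw [hm_def]; exact_mod_cast classNumber_pos K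
  have hB : 0 ≤ B := by rw [hB_def]; positivity
  have himp : ℓ < n * A → m * n ≤ (B * n / (n * A - ℓ)) ^ 2 := fun hsmall ↦ by
    have h := classNumber_mul_finrank_le K hsmall
    push_cast at h
    exact h
  by_contra hlt
  push Not at hlt
  have hs0 : 0 ≤ Real.sqrt (n / m) := Real.sqrt_nonneg _
  have hδ : 0 < n * A - ℓ := by nlinarith
  have h1 := himp (by nlinarith)
  have hq : 0 ≤ B * n / (n * A - ℓ) := by positivity
  have h2 : Real.sqrt (m * n) ≤ B * n / (n * A - ℓ) := by
    rw [← Real.sqrt_sq hq]; exact Real.sqrt_le_sqrt h1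
  have h3 : (n * A - ℓ) * Real.sqrt (m * n) ≤ B * n := by
    have := mul_le_mul_of_nonneg_left h2 hδ.le
    rwa [mul_div_cancel₀ _ hδ.ne'] at this
  have hmn : 0 < Real.sqrt (m * n) := Real.sqrt_pos.2 (by positivity)
  have h4 : B * n = B * Real.sqrt (n / m) * Real.sqrt (m * n) := by
    rw [mul_assoc, ← Real.sqrt_mul (by positivity),
      show n / m * (m * n) = n ^ 2 by field_simp, Real.sqrt_sq hn.le]
  rw [h4] at h3
  have h5 : n * A - ℓ ≤ B * Real.sqrt (n / m) := le_of_mul_le_mul_right h3 hmn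
  linarith

end Discriminant

end Summit.QuantumAdvantage.QuantumAdvantage.Theorems.DegreeOnePrimesEscape

end
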